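import Summits.RiemannHypothesis.RiemannHypothesis.Theorems.PfPersistenceM2EvenSectorUnconditional
import Summits.RiemannHypothesis.RiemannHypothesis.Theorems.PfPersistenceTwoParityIndexFamilies
import Literature.NumberTheory.LFunctions.UniformWeilPositivityRH
import HarnessLib

/-!
# Pf-persistence index route (M2): short windows are index-blind; the threshold windows

Long-odds MECHANISM SEARCH (cell `pub-rhpf`, seat M2); every result here is RH-free and makes no
claim about RH.  Notation: `𝒬 = {ρ : ζ(ρ) = 0 non-trivial, Re ρ > 1/2, Im ρ > 0}`, `K = #𝒬 ∈ ℕ ∪ {∞}`,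
`EvenNegIndexAtLeast n a` / `OddNegIndexAtLeast n a` / `RealNegIndexAtLeast n a` = the window
`[-a, a]` carries `n` even / odd / real compactly supported Weil tests spanning a negative definite
subspace of `Re Q` (`Q = weilQuadratic`).

The two-parity ladder says the negative indices of LONG windows count the off-line zeros
(`K`, `K`, `2K`).  This file records the complementary SHORT-window statement and the resulting
threshold picture, all unconditional:
* `not_realNegIndexAtLeast_succ_of_weilPositivityOn` (and even / odd) — Weil positivity on
  `[-a, a]` kills every negative direction there;
* `not_realNegIndexAtLeast_succ_of_le_log_two_half` (and even / odd),
  `iSup_realNegIndex_eq_zero_of_le_log_two_half` (and even / odd) — by YOSHIDA'S THEOREM 1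
  (proved in the tree: `weilPositivityOn_log_two_half_holds`, `weilPositivityOn_of_le_log_two_half`)
  every window with `a ≤ (log 2)/2` has all three negative indices `0`, whatever `K` is;
* `exists_evenNegIndex_threshold` — for every level `n + 1 ≤ K` there is a THRESHOLD
  `aₙ ≥ (log 2)/2` with no `n + 1` negative even directions on `[-a, a]` for `a < aₙ` and `n + 1` of
  them for every `a > aₙ` (monotonicity in `a` + the unconditional even ladder);
  `exists_evenNegIndex_threshold_of_not_riemannHypothesis` — off RH the first threshold `a₀` exists.
Nothing here says whether `K = 0` (RH): under RH there are no thresholds at all, off RH they start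
above `(log 2)/2`.
-/

noncomputable section

open Filter Set
open scoped Topology

namespace Summit.RiemannHypothesis.RiemannHypothesis.Theorems.PfPersistenceM2NegIndex

open Literature.NumberTheory.LFunctions
open Literature.NumberTheory.LFunctions.ZetaZeros
open Summit.RiemannHypothesis.RiemannHypothesis.Theorems.PfPersistenceParityIndex
  (OddNegIndexAtLeast riemannHypothesis_iff_quadrant_eq_empty)

/-! ## A. Positivity on a window kills every negative direction there -/

/-- If `Re Q ≥ 0` on all Weil tests supported in `[-a, a]`, the window carries no negative real
direction (test the family against the coefficient vector `e₀`). [folklore] -/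
theorem not_realNegIndexAtLeast_succ_of_weilPositivityOn {a : ℝ} (h : WeilPositivityOn a) (n : ℕ) :
    ¬ RealNegIndexAtLeast (n + 1) a := by
  classical
  rintro ⟨g, hg, -, hsupp, hneg⟩
  have hc : (Pi.single 0 1 : Fin (n + 1) → ℝ) ≠ 0 := fun h0 ↦ by
    have := congrFun h0 0
    simp at this
  have hfun : (fun t : ℝ ↦ ∑ i, ((Pi.single 0 1 : Fin (n + 1) → ℝ) i : ℂ) * g i t) = g 0 := by
    funext t
    rw [Finset.sum_eq_single (0 : Fin (n + 1))]
    · simp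
    · intro i _ hi
      simp [Pi.single_eq_of_ne hi]
    · simp
  have hlt := hneg _ hc
  rw [hfun] at hlt
  exact absurd hlt (not_lt.2 (h (g 0) (hg 0) (hsupp 0)))

/-- Even version. [folklore] -/
theorem not_evenNegIndexAtLeast_succ_of_weilPositivityOn {a : ℝ} (h : WeilPositivityOn a) (n : ℕ) :
    ¬ EvenNegIndexAtLeast (n + 1) a :=
  fun h' ↦ not_realNegIndexAtLeast_succ_of_weilPositivityOn h n h'.toReal

/-- Odd version. [folklore] -/
theorem not_oddNegIndexAtLeast_succ_of_weilPositivityOn {a : ℝ} (h : WeilPositivityOn a) (n : ℕ) :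
    ¬ OddNegIndexAtLeast (n + 1) a :=
  fun h' ↦ not_realNegIndexAtLeast_succ_of_weilPositivityOn h n
    (PfPersistenceParityIndex.OddNegIndexAtLeast.toReal h')

/-! ## B. Yoshida's range: windows with `a ≤ (log 2)/2` are index-blind (unconditional) -/

/-- **Short windows carry no negative real direction**: `a ≤ (log 2)/2 ⟹ ¬ RealNegIndexAtLeast (n+1) a`
(Yoshida 1992 Thm 1, a theorem of the tree). [cite: Yoshida1992, Thm. 1 (p. 310)] -/
theorem not_realNegIndexAtLeast_succ_of_le_log_two_half {a : ℝ} (hle : a ≤ Real.log 2 / 2) (n : ℕ) :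
    ¬ RealNegIndexAtLeast (n + 1) a :=
  not_realNegIndexAtLeast_succ_of_weilPositivityOn (weilPositivityOn_of_le_log_two_half hle) n

/-- Even version. [cite: Yoshida1992, Thm. 1 (p. 310)] -/
theorem not_evenNegIndexAtLeast_succ_of_le_log_two_half {a : ℝ} (hle : a ≤ Real.log 2 / 2) (n : ℕ) :
    ¬ EvenNegIndexAtLeast (n + 1) a :=
  not_evenNegIndexAtLeast_succ_of_weilPositivityOn (weilPositivityOn_of_le_log_two_half hle) n

/-- Odd version. [cite: Yoshida1992, Thm. 1 (p. 310)] -/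
theorem not_oddNegIndexAtLeast_succ_of_le_log_two_half {a : ℝ} (hle : a ≤ Real.log 2 / 2) (n : ℕ) :
    ¬ OddNegIndexAtLeast (n + 1) a :=
  not_oddNegIndexAtLeast_succ_of_weilPositivityOn (weilPositivityOn_of_le_log_two_half hle) n

/-- Abstract: a predicate with no level `n + 1` has index number `0`. [folklore] -/
theorem iSup_natCast_eq_zero_of_forall_not_succ {P : ℕ → Prop} (h : ∀ n, ¬ P (n + 1)) :
    (⨆ n : ℕ, ⨆ _ : P n, (n : ℕ∞)) = 0 := by
  refine le_antisymm (iSup_le fun n ↦ iSup_le fun hn ↦ ?_) bot_le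
  cases n with
  | zero => simp
  | succ k => exact absurd hn (h k)

/-- **`ind⁻_re(a) = 0` for `a ≤ (log 2)/2`** (whatever `K` is). [cite: Yoshida1992, Thm. 1 (p. 310)] -/
theorem iSup_realNegIndex_eq_zero_of_le_log_two_half {a : ℝ} (hle : a ≤ Real.log 2 / 2) :
    (⨆ n : ℕ, ⨆ _ : RealNegIndexAtLeast n a, (n : ℕ∞)) = 0 :=
  iSup_natCast_eq_zero_of_forall_not_succ (not_realNegIndexAtLeast_succ_of_le_log_two_half hle)

/-- `ind⁻_ev(a) = 0` for `a ≤ (log 2)/2`. [cite: Yoshida1992, Thm. 1 (p. 310)] -/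
theorem iSup_evenNegIndex_eq_zero_of_le_log_two_half {a : ℝ} (hle : a ≤ Real.log 2 / 2) :
    (⨆ n : ℕ, ⨆ _ : EvenNegIndexAtLeast n a, (n : ℕ∞)) = 0 :=
  iSup_natCast_eq_zero_of_forall_not_succ (not_evenNegIndexAtLeast_succ_of_le_log_two_half hle)

/-- `ind⁻_od(a) = 0` for `a ≤ (log 2)/2`. [cite: Yoshida1992, Thm. 1 (p. 310)] -/
theorem iSup_oddNegIndex_eq_zero_of_le_log_two_half {a : ℝ} (hle : a ≤ Real.log 2 / 2) :
    (⨆ n : ℕ, ⨆ _ : OddNegIndexAtLeast n a, (n : ℕ∞)) = 0 :=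
  iSup_natCast_eq_zero_of_forall_not_succ (not_oddNegIndexAtLeast_succ_of_le_log_two_half hle)

/-! ## C. Threshold windows -/

/-- **Threshold window at level `n + 1`.**  If `n + 1 ≤ K`, there is `aₙ ≥ (log 2)/2` such that
`[-a, a]` carries NO `n + 1` independent negative even directions for `a < aₙ` and DOES for every
`a > aₙ` (`aₙ = inf {a : EvenNegIndexAtLeast (n+1) a}`; the set is non-empty by the unconditional even
ladder, bounded below by Yoshida, and an upper set by monotonicity). RH-free.
[cite: Bombieri2000Weil, Thm 9 (even part); Yoshida1992, Thm. 1] -/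
theorem exists_evenNegIndex_threshold {n : ℕ}
    (hK : ((n + 1 : ℕ) : ℕ∞) ≤ {ρ : ℂ | ρ ∈ riemannZetaNontrivialZeros ∧ 1 / 2 < ρ.re ∧ 0 < ρ.im}.encard) :
    ∃ a₀ : ℝ, Real.log 2 / 2 ≤ a₀ ∧ (∀ a < a₀, ¬ EvenNegIndexAtLeast (n + 1) a) ∧
      ∀ a > a₀, EvenNegIndexAtLeast (n + 1) a := by
  have hne : {a : ℝ | EvenNegIndexAtLeast (n + 1) a}.Nonempty :=
    (exists_evenNegIndexAtLeast_iff_encard (n + 1)).2 hK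
  have hlow : ∀ a ∈ {a : ℝ | EvenNegIndexAtLeast (n + 1) a}, Real.log 2 / 2 ≤ a := fun a ha ↦ by
    by_contra hlt
    exact not_evenNegIndexAtLeast_succ_of_le_log_two_half (le_of_lt (not_le.1 hlt)) n ha
  have hbdd : BddBelow {a : ℝ | EvenNegIndexAtLeast (n + 1) a} := ⟨Real.log 2 / 2, hlow⟩
  refine ⟨sInf {a : ℝ | EvenNegIndexAtLeast (n + 1) a}, le_csInf hne hlow, fun a ha hneg ↦ ?_,
    fun a ha ↦ ?_⟩
  · exact absurd (csInf_le hbdd hneg) (not_le.2 ha)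
  · obtain ⟨b, hb, hba⟩ := exists_lt_of_csInf_lt hne ha
    exact EvenNegIndexAtLeast.mono hb hba.le

/-- **Off RH the first threshold exists**: `¬ RH ⟹ ∃ a₀ ≥ (log 2)/2`, no negative even direction on
`[-a, a]` for `a < a₀`, one on every `[-a, a]` with `a > a₀`. (Under RH there is none at any `a`.)
RH-free; no claim about which case holds. [cite: Bombieri2000Weil, Thm 9; Yoshida1992, Thm. 1] -/
theorem exists_evenNegIndex_threshold_of_not_riemannHypothesis (hRH : ¬ RiemannHypothesis) :
    ∃ a₀ : ℝ, Real.log 2 / 2 ≤ a₀ ∧ (∀ a < a₀, ¬ EvenNegIndexAtLeast 1 a) ∧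
      ∀ a > a₀, EvenNegIndexAtLeast 1 a := by
  refine exists_evenNegIndex_threshold (n := 0) ?_
  have hne : {ρ : ℂ | ρ ∈ riemannZetaNontrivialZeros ∧ 1 / 2 < ρ.re ∧ 0 < ρ.im}.Nonempty := by
    rw [nonempty_iff_ne_empty]
    exact fun h ↦ hRH (riemannHypothesis_iff_quadrant_eq_empty.2 h)
  have h1 := encard_pos.2 hne
  exact Order.one_le_iff_pos.2 h1

end Summit.RiemannHypothesis.RiemannHypothesis.Theorems.PfPersistenceM2NegIndex

end
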